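import Summits.CriticalPhenomena.CardyFormulaZ2.Theorems.CardyIKTransportIKMixedBoxCrossingDefectStubNoiseOp
import Summits.CriticalPhenomena.CardyFormulaZ2.Theorems.CardyIKTransportIKMixedBoxCrossingDefectStubCondBox

/-!
# Helper `exteriorRow_L2_robust` (FKG-free exterior-row `L²` robustness) for the line
# `defect-closure-exploration` (crux `IKMixedBoxCrossing`, stmt-CriticalPhenomena-5911)

Support file (`--supports stmt-CriticalPhenomena-5911`), ingredient (W-c). For every column pattern `S`, every box
`U = [a, a + k) × [1, h]` sitting on the cell row `0` and every event `E` determined by `U`,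

  `2 ^ k · Σ_ξ ν(E ∩ C_ξ)² ≤ ν(E)² + ρ² / 4`, `ρ = 7 − 4√3`, `ν = νmix S`,

where `C_ξ` (`ξ : Fin k → Bool`) is the cylinder prescribing the colours of the `k` cells of row `0` below the box;
equivalently `Var_ξ ν(E | C_ξ) ≤ ρ² / 4` for the uniform law of `ξ`.

PROOF (pure assembly of the two landed helpers). By `CondBoxStub.main` (the tilt representation, `k = n + 1`)
`2 ^ k ν(E ∩ C_ξ) = (T H)(incr ξ)` with `H ∈ [0, 1]` a function of the increments `incr ξ : Fin n → Bool`,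
`T` the noise operator with flip probabilities `p_i = 2√3 − 3` on `S`-columns and `½` elsewhere, so that
`|1 − 2 p_i| ≤ ρ`. The increment map is two-to-one (`sum_incr_eq`), the cylinders partition (`sum_real_inter_cyl`),
hence the mean of `T H` is `ν(E)` and `2 ^ k Σ_ξ ν(E ∩ C_ξ)² = Var(T H) + ν(E)²`; finally
`Var(T H) ≤ ρ² Var H` (`noiseOp_variance_le`) and `Var H ≤ 1/4` for `H ∈ [0, 1]` (`var_le_quarter`).
-/

noncomputable section

namespace Summit.CriticalPhenomena.CardyFormulaZ2.Cruxes.IKMixedBoxCrossing.DefectClosureExploration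

open scoped Classical BigOperators
open MeasureTheory ProbabilityTheory Set Finset
open Literature.Probability.Percolation Literature.Probability.LatticeModels
open Summit.CriticalPhenomena.CardyFormulaZ2.Theorems.IKLinearTransport.PinnedDiagramExchange (Obs νmix determinedOn
  isProbabilityMeasure_nuMix)

namespace L2RobustStub

/-! ## §1 Combinatorics of the increment map and the cylinder partition -/

/-- The increment map `ξ ↦ (ξ_i ⊕ ξ_{i+1})_i : (Fin (n + 1) → Bool) → (Fin n → Bool)` is two-to-one:
`Σ_ξ g (incr ξ) = 2 Σ_s g s`. -/
theorem sum_incr_eq (n : ℕ) (g : (Fin n → Bool) → ℝ) :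
    ∑ ξ : Fin (n + 1) → Bool, g (fun i => xor (ξ i.castSucc) (ξ i.succ)) = 2 * ∑ s : Fin n → Bool, g s := by
  have hinj : Function.Injective fun ξ : Fin (n + 1) → Bool => (ξ 0, fun i : Fin n => xor (ξ i.castSucc) (ξ i.succ)) :=
    fun ξ ξ' hξ => by
      simp only [Prod.mk.injEq] at hξ
      exact CondBoxStub.eq_of_incr_eq hξ.1 fun i => congrFun hξ.2 i
  have hbij : Function.Bijective fun ξ : Fin (n + 1) → Bool => (ξ 0, fun i : Fin n => xor (ξ i.castSucc) (ξ i.succ)) :=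
    (Fintype.bijective_iff_injective_and_card _).2 ⟨hinj, by simp [pow_succ']⟩
  calc ∑ ξ : Fin (n + 1) → Bool, g (fun i => xor (ξ i.castSucc) (ξ i.succ))
      = ∑ ξ : Fin (n + 1) → Bool, (fun bs : Bool × (Fin n → Bool) => g bs.2)
          (ξ 0, fun i : Fin n => xor (ξ i.castSucc) (ξ i.succ)) := rfl
    _ = ∑ bs : Bool × (Fin n → Bool), g bs.2 := hbij.sum_comp fun bs : Bool × (Fin n → Bool) => g bs.2
    _ = 2 * ∑ s : Fin n → Bool, g s := by simp only [Fintype.sum_prod_type, Fintype.sum_bool, two_mul]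

/-- The row-`0` cylinders `C_ξ`, `ξ : Fin k → Bool`, partition the space of observables:
`Σ_ξ ν(E ∩ C_ξ) = ν(E)` (for every set `E`, measurable or not). -/
theorem sum_real_inter_cyl (S : Set ℤ) (a : ℤ) (k : ℕ) (E : Set Obs) :
    ∑ ξ : Fin k → Bool, (νmix S).real (E ∩ {x | ∀ i : Fin k, ((![a + i, 0] : Site 2) ∈ x.1 ↔ ξ i = true)}) =
      (νmix S).real E := by
  haveI := isProbabilityMeasure_nuMix S
  have hV : ∀ ξ : Fin k → Bool, (fun (x : Obs) (i : Fin k) => decide ((![a + i, 0] : Site 2) ∈ x.1)) ⁻¹' {ξ} =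
      {x : Obs | ∀ i : Fin k, ((![a + i, 0] : Site 2) ∈ x.1 ↔ ξ i = true)} := fun ξ => Set.ext fun x => by
    simp only [Set.mem_preimage, Set.mem_singleton_iff, funext_iff, CondBoxStub.decide_eq_bool_iff, Set.mem_setOf_eq]
  have hmC : ∀ ξ : Fin k → Bool, MeasurableSet {x : Obs | ∀ i : Fin k, ((![a + i, 0] : Site 2) ∈ x.1 ↔ ξ i = true)} :=
    fun ξ => measurableSet_setOf.2 (Measurable.forall fun i => ((measurable_set_mem _).comp measurable_fst).iff measurable_const)
  have hs := sum_measureReal_preimage_singleton (μ := (νmix S).restrict E) Finset.univ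
    (f := fun (x : Obs) (i : Fin k) => decide ((![a + i, 0] : Site 2) ∈ x.1)) (fun ξ _ => (hV ξ) ▸ hmC ξ)
  rw [Finset.coe_univ, Set.preimage_univ, measureReal_restrict_apply_univ] at hs
  rw [← hs]
  exact Finset.sum_congr rfl fun ξ _ => by rw [measureReal_restrict_apply ((hV ξ) ▸ hmC ξ), hV, Set.inter_comm]

/-! ## §2 Real arithmetic -/

/-- A `[0, 1]`-valued function on the cube has variance at most `1/4`. -/
theorem var_le_quarter (n : ℕ) (H : (Fin n → Bool) → ℝ) (hH : ∀ s, 0 ≤ H s ∧ H s ≤ 1) :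
    (∑ s, (H s - (∑ t, H t) / 2 ^ n) ^ 2) / 2 ^ n ≤ 1 / 4 := by
  rw [NoiseOpStub.sum_sq_sub_mean]
  have hN : (0 : ℝ) < 2 ^ n := by positivity
  have h1 : ∑ s, H s ^ 2 ≤ ∑ s, H s := Finset.sum_le_sum fun s _ => by nlinarith [hH s]
  have h2 : (∑ s, H s) - (∑ s, H s) ^ 2 / 2 ^ n = 2 ^ n / 4 - ((∑ s, H s) - 2 ^ n / 2) ^ 2 / 2 ^ n := by
    field_simp
    ring
  have h3 : 0 ≤ ((∑ s, H s) - 2 ^ n / 2) ^ 2 / 2 ^ n := by positivity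
  rw [div_le_iff₀ hN]
  linarith

/-- ASSEMBLY (abstract form). If `2 ^ (n+1) c(ξ) = T(incr ξ)`, `Σ_ξ c(ξ) = P`, `Var T ≤ r² Var H` and `H ∈ [0, 1]`,
then `2 ^ (n+1) Σ_ξ c(ξ)² ≤ P² + r² / 4`. -/
theorem assembly (n : ℕ) (c : (Fin (n + 1) → Bool) → ℝ) (T H : (Fin n → Bool) → ℝ) (r P : ℝ)
    (hq : ∀ ξ, 2 ^ (n + 1) * c ξ = T (fun i => xor (ξ i.castSucc) (ξ i.succ)))
    (hpart : ∑ ξ, c ξ = P)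
    (hvar : (∑ s, (T s - (∑ t, T t) / 2 ^ n) ^ 2) / 2 ^ n ≤ r ^ 2 * ((∑ s, (H s - (∑ t, H t) / 2 ^ n) ^ 2) / 2 ^ n))
    (hH : ∀ s, 0 ≤ H s ∧ H s ≤ 1) :
    2 ^ (n + 1) * ∑ ξ, c ξ ^ 2 ≤ P ^ 2 + r ^ 2 / 4 := by
  have hN : (0 : ℝ) < 2 ^ n := by positivity
  have hN1 : (2 : ℝ) ^ (n + 1) ≠ 0 := by positivity
  -- the mean of `T` is `P`
  have hA : ∑ s, T s = 2 ^ n * P := by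
    have h2 : 2 * ∑ s, T s = 2 ^ (n + 1) * P := by
      rw [← sum_incr_eq n T, ← hpart, Finset.mul_sum]
      exact Finset.sum_congr rfl fun ξ _ => (hq ξ).symm
    rw [pow_succ', mul_assoc] at h2
    exact mul_left_cancel₀ two_ne_zero h2
  -- the second moment
  have hc : ∀ ξ, c ξ = T (fun i => xor (ξ i.castSucc) (ξ i.succ)) / 2 ^ (n + 1) := fun ξ => by
    rw [← hq ξ, mul_div_cancel_left₀ _ hN1]
  have h3 : ∑ ξ : Fin (n + 1) → Bool, T (fun i => xor (ξ i.castSucc) (ξ i.succ)) ^ 2 = 2 * ∑ s, T s ^ 2 :=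
    sum_incr_eq n fun s => T s ^ 2
  have hsq : 2 ^ (n + 1) * ∑ ξ, c ξ ^ 2 = (∑ s, (T s - (∑ t, T t) / 2 ^ n) ^ 2) / 2 ^ n + P ^ 2 := by
    simp_rw [hc, div_pow]
    rw [← Finset.sum_div, h3, NoiseOpStub.sum_sq_sub_mean, hA]
    field_simp
    ring
  rw [hsq]
  have h4 : r ^ 2 * ((∑ s, (H s - (∑ t, H t) / 2 ^ n) ^ 2) / 2 ^ n) ≤ r ^ 2 * (1 / 4) :=
    mul_le_mul_of_nonneg_left (var_le_quarter n H hH) (sq_nonneg r)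
  linarith

/-- The flip probabilities `2√3 − 3` (on `S`-columns) and `½` (elsewhere) lie in `[0, 1]` and satisfy
`|1 − 2p| ≤ 7 − 4√3`. -/
theorem flip_prob_bounds (P : Prop) [Decidable P] :
    0 ≤ (if P then 2 * Real.sqrt 3 - 3 else 1 / 2 : ℝ) ∧ (if P then 2 * Real.sqrt 3 - 3 else 1 / 2 : ℝ) ≤ 1 ∧
      |1 - 2 * (if P then 2 * Real.sqrt 3 - 3 else 1 / 2 : ℝ)| ≤ 7 - 4 * Real.sqrt 3 := by
  have ⟨h1, h2⟩ := Summit.CriticalPhenomena.CardyFormulaZ2.Theorems.IKMixedBoxCrossing.Negative.sqrt3_bounds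
  split_ifs
  · refine ⟨by linarith, by linarith, ?_⟩
    rw [abs_of_nonneg (by linarith)]
    linarith
  · norm_num
    linarith

end L2RobustStub

/-- **Registered helper `exteriorRow_L2_robust`** (EXTERIOR-ROW `L²` ROBUSTNESS, line `defect-closure-exploration`):
`2 ^ k Σ_ξ ν(E ∩ C_ξ)² ≤ ν(E)² + ρ² / 4`, `ρ = 7 − 4√3`, for every column pattern `S`, every box
`[a, a + k) × [1, h]` sitting on the conditioning row `0` and every event `E` of the box; i.e. the conditional
probabilities `ν(E | C_ξ)` have variance at most `ρ² / 4` in the uniformly distributed boundary colouring `ξ`. -/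
theorem exteriorRow_L2_robust : ∀ (S : Set ℤ) (a : ℤ) (k h : ℕ) (E : Set Obs), MeasurableSet E →
    E ∈ determinedOn {v : Site 2 | a ≤ v 0 ∧ v 0 < a + k ∧ 1 ≤ v 1 ∧ v 1 ≤ h} →
    (2 : ℝ) ^ k * ∑ ξ : Fin k → Bool,
        ((νmix S).real (E ∩ {x | ∀ i : Fin k, ((![a + i, 0] : Site 2) ∈ x.1 ↔ ξ i = true)})) ^ 2 ≤
      ((νmix S).real E) ^ 2 + (7 - 4 * Real.sqrt 3) ^ 2 / 4 := by
  intro S a k h E hEm hE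
  obtain _ | n := k
  · have hC : ∀ ξ : Fin 0 → Bool, {x : Obs | ∀ i : Fin 0, ((![a + i, 0] : Site 2) ∈ x.1 ↔ ξ i = true)} = Set.univ :=
      fun ξ => Set.eq_univ_of_forall fun x i => i.elim0
    simp only [hC, Set.inter_univ, pow_zero, one_mul, Fintype.sum_unique]
    exact le_add_of_nonneg_right (by positivity)
  · obtain ⟨H, hH, hq⟩ := CondBoxStub.main S a n h E hEm hE
    exact L2RobustStub.assembly n
      (fun ξ => (νmix S).real (E ∩ {x | ∀ i : Fin (n + 1), ((![a + i, 0] : Site 2) ∈ x.1 ↔ ξ i = true)}))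
      (fun s => ∑ ε : Fin n → Bool,
        (∏ i, if ε i then (if (a + i : ℤ) ∈ S then 2 * Real.sqrt 3 - 3 else 1 / 2)
          else 1 - (if (a + i : ℤ) ∈ S then 2 * Real.sqrt 3 - 3 else 1 / 2)) * H (fun i => xor (s i) (ε i)))
      H (7 - 4 * Real.sqrt 3) ((νmix S).real E) hq (L2RobustStub.sum_real_inter_cyl S a (n + 1) E)
      (noiseOp_variance_le n (fun i : Fin n => if (a + i : ℤ) ∈ S then 2 * Real.sqrt 3 - 3 else 1 / 2)
        (7 - 4 * Real.sqrt 3) (fun i => L2RobustStub.flip_prob_bounds _) H) hH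

end Summit.CriticalPhenomena.CardyFormulaZ2.Cruxes.IKMixedBoxCrossing.DefectClosureExploration

end
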